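import Mathlib
import Summits.NavierStokesRegularity.NavierStokesRegularity.Theorems.EulerZoomLiouvillePowerGaugeEulerLiouvilleCondenserCore
import Summits.NavierStokesRegularity.NavierStokesRegularity.Theorems.EulerZoomLiouvillePowerGaugeEulerLiouvilleCondenserQuietPlane

/-!
# THE CONDENSER CORE on a coordinate plane of `ℝ³` (ROUND-42 (B3)+(B4) in the frame of t42-QP)

Width piece for crux `EulerZoomLiouville.PowerGaugeEulerLiouville` (stmt-NavierStokesRegularity-19832), by name under
LEAD 19832 (ns-typeII-p2 g12); seat ns-ezl-w2 g3, `--supports stmt-NavierStokesRegularity-19832 --as helper`.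
Glue between ns-ezl-w7 g0's t42-QP (`plane s a = (a 0, a 1, s)`, the slice integrals
`∫ a, 𝟙_{B(0,3R)} F (plane s a)` of `exists_quietPlane`) and the chart-level condenser core
`exp_le_gradient_or_small_of_chart` (t42-CORE):

* `finTwoArrow_symm_apply_zero/one`, `chart_eq_plane` — the orthonormal chart `q ↦ y₁ + q.1•e₀ + q.2•e₁` of the plane
  `{x 2 = y₁ 2}` through `y₁` is `plane (y₁ 2) (c + toLp ![q.1, q.2])`, `c = toLp ![y₁ 0, y₁ 1]`.
* `measurePreserving_planeChart` — `q ↦ c + toLp ![q.1, q.2] : ℝ × ℝ → E²` preserves volume.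
* `setIntegral_chart_le_integral_plane` — for continuous `G ≥ 0` and `‖y₁‖ + 2r★ < 3R`:
  `∫_{[−r★,r★]²} G(y₁ + q.1•e₀ + q.2•e₁) dq ≤ ∫ a, 𝟙_{B(0,3R)} G (plane (y₁ 2) a)`.
* **`exp_le_gradient_or_small_of_plane`** — an ANOMALOUS point `y₁` (`‖V y₁‖ ≥ m > 0`) on a slice whose t42-QP budgets
  are `≤ A` (for `‖V‖²`) and `≤ E` (for `‖DV‖²`), with `‖DV‖ ≤ G_m` on `closedBall y₁ r★`, `‖y₁‖ + 2r★ < 3R` and room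
  `8A/(π m²) ≤ (3/4) r★²`, forces `(m/(4r★))·exp(π m²/(32E)) ≤ √2·G_m ∨ π m²/(32E) ≤ log 2`.

WHAT REMAINS for nsreg-p2 g33's THEOREM B in `ℝ³`: the first exit time from `B(0,2R)` (t42a `exists_firstHit_of_exit`),
a rotation taking the exit direction to `e₂` (tree `ClassIsometry`), ns-in-ser-c g3's t42a-PLANAR first hit `y_s` of the
plane with `γ s ≤ ‖V y_s‖`, and `exists_quietPlane`; then this file with `m = γ s`.

HONEST FRAMING: real analysis in `ℝ³`; nothing here proves the crux E `PowerGaugeEulerLiouville` (19832 OPEN), any door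
Target, or any Navier–Stokes statement; MODEL lattice only (19832 is a crux CLASS — E/NS strata — not NS regularity).
[folklore (length–area method); cite: ConstantinIgnatovaVicol2026Putative, §3.4.1 for the setting]
-/

noncomputable section

open Set Filter Topology Metric Function MeasureTheory Real
open scoped RealInnerProductSpace

set_option linter.dupNamespace false

namespace Summit.NavierStokesRegularity.NavierStokesRegularity.Theorems.PowerGaugeEulerLiouville.Condenser

/-- `finTwoArrow.symm q 0 = q.1`. [folklore] -/
@[simp] theorem finTwoArrow_symm_apply_zero (q : ℝ × ℝ) : (MeasurableEquiv.finTwoArrow (α := ℝ)).symm q 0 = q.1 :=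
  rfl

/-- `finTwoArrow.symm q 1 = q.2`. [folklore] -/
@[simp] theorem finTwoArrow_symm_apply_one (q : ℝ × ℝ) : (MeasurableEquiv.finTwoArrow (α := ℝ)).symm q 1 = q.2 :=
  rfl

/-- The orthonormal chart of the coordinate plane through `y₁` is a slice of t42-QP's `plane`:
`y₁ + q.1•e₀ + q.2•e₁ = plane (y₁ 2) (toLp ![y₁ 0, y₁ 1] + toLp ![q.1, q.2])`. [folklore] -/
theorem chart_eq_plane (y₁ : EuclideanSpace ℝ (Fin 3)) (q : ℝ × ℝ) :
    y₁ + q.1 • EuclideanSpace.basisFun (Fin 3) ℝ 0 + q.2 • EuclideanSpace.basisFun (Fin 3) ℝ 1 =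
      plane (y₁ 2) ((WithLp.toLp 2 ![y₁ 0, y₁ 1] : EuclideanSpace ℝ (Fin 2)) +
        WithLp.toLp 2 ((MeasurableEquiv.finTwoArrow (α := ℝ)).symm q)) := by
  ext i
  fin_cases i <;> simp [plane, EuclideanSpace.basisFun_apply]

/-- The affine chart `q ↦ toLp ![y₁ 0, y₁ 1] + toLp ![q.1, q.2] : ℝ × ℝ → E²` preserves Lebesgue measure. [folklore] -/
theorem measurePreserving_planeChart (c : EuclideanSpace ℝ (Fin 2)) :
    MeasurePreserving (fun q : ℝ × ℝ =>
      c + (WithLp.toLp 2 ((MeasurableEquiv.finTwoArrow (α := ℝ)).symm q) : EuclideanSpace ℝ (Fin 2))) volume volume :=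
  (measurePreserving_add_left volume c).comp
    ((PiLp.volume_preserving_toLp (Fin 2)).comp (volume_preserving_finTwoArrow ℝ).symm)

/-- **Chart square integral ≤ slice integral.**  For continuous `G ≥ 0` on `ℝ³` and `‖y₁‖ + 2r★ < 3R`:
`∫_{[−r★,r★]²} G(y₁ + q.1•e₀ + q.2•e₁) dq ≤ ∫ a, 𝟙_{B(0,3R)} G (plane (y₁ 2) a)`. [folklore] -/
theorem setIntegral_chart_le_integral_plane {G : EuclideanSpace ℝ (Fin 3) → ℝ} (hGc : Continuous G)
    (hG0 : ∀ x, 0 ≤ G x) {y₁ : EuclideanSpace ℝ (Fin 3)} {R rs : ℝ} (hfit : ‖y₁‖ + 2 * rs < 3 * R) :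
    ∫ q in closedBall (0 : ℝ × ℝ) rs,
        G (y₁ + q.1 • EuclideanSpace.basisFun (Fin 3) ℝ 0 + q.2 • EuclideanSpace.basisFun (Fin 3) ℝ 1) ≤
      ∫ a, (ball (0 : EuclideanSpace ℝ (Fin 3)) (3 * R)).indicator G (plane (y₁ 2) a) := by
  set s : ℝ := y₁ 2 with hs
  set c : EuclideanSpace ℝ (Fin 2) := WithLp.toLp 2 ![y₁ 0, y₁ 1] with hc
  set Φ : ℝ × ℝ → EuclideanSpace ℝ (Fin 2) := fun q =>
    c + (WithLp.toLp 2 ((MeasurableEquiv.finTwoArrow (α := ℝ)).symm q) : EuclideanSpace ℝ (Fin 2)) with hΦ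
  have hΦmp : MeasurePreserving Φ volume volume := measurePreserving_planeChart c
  set h : EuclideanSpace ℝ (Fin 2) → ℝ := fun a =>
    (ball (0 : EuclideanSpace ℝ (Fin 3)) (3 * R)).indicator G (plane s a) with hh
  -- `plane s` is continuous, hence `h` is measurable and nonnegative, integrable (bounded support)
  have hplane_c : Continuous (plane s) := by
    refine (PiLp.continuous_toLp 2 _).comp ?_
    refine continuous_pi fun i => ?_
    fin_cases i
    · exact PiLp.continuous_apply 2 _ 0
    · exact PiLp.continuous_apply 2 _ 1
    · exact continuous_const
  have hnorm_le : ∀ a : EuclideanSpace ℝ (Fin 2), ‖a‖ ≤ ‖plane s a‖ := by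
    intro a
    have h2 : ‖a‖ ^ 2 ≤ ‖plane s a‖ ^ 2 := by
      rw [EuclideanSpace.norm_sq_eq, EuclideanSpace.norm_sq_eq, Fin.sum_univ_two, Fin.sum_univ_three]
      simp [plane]
      nlinarith [sq_nonneg s]
    exact le_of_pow_le_pow_left₀ two_ne_zero (norm_nonneg _) h2
  set S' : Set (EuclideanSpace ℝ (Fin 2)) := plane s ⁻¹' ball (0 : EuclideanSpace ℝ (Fin 3)) (3 * R) with hS'
  have hS'm : MeasurableSet S' := measurableSet_ball.preimage hplane_c.measurable
  have hS'sub : S' ⊆ closedBall (0 : EuclideanSpace ℝ (Fin 2)) (3 * R) := by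
    intro a ha
    rw [mem_closedBall, dist_zero_right]
    have : ‖plane s a‖ < 3 * R := by simpa [hS'] using ha
    exact ((hnorm_le a).trans this.le)
  have hh_eq : h = S'.indicator (G ∘ plane s) := by
    funext a
    simp only [hh, hS']
    exact (Set.indicator_comp_right (plane s)
      (s := ball (0 : EuclideanSpace ℝ (Fin 3)) (3 * R)) (g := G)).symm
  have hh_int : Integrable h := by
    rw [hh_eq, integrable_indicator_iff hS'm]
    exact ((hGc.comp hplane_c).continuousOn.integrableOn_compact (isCompact_closedBall 0 (3 * R))).mono_set hS'sub
  have hh0 : ∀ a, 0 ≤ h a := fun a => Set.indicator_nonneg (fun x _ => hG0 x) _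
  -- on the square, the chart integrand is `h ∘ Φ`
  have hpt : ∀ q ∈ closedBall (0 : ℝ × ℝ) rs,
      G (y₁ + q.1 • EuclideanSpace.basisFun (Fin 3) ℝ 0 + q.2 • EuclideanSpace.basisFun (Fin 3) ℝ 1) = h (Φ q) := by
    intro q hq
    have heq := chart_eq_plane y₁ q
    simp only [hh, hΦ, hs, hc]
    rw [← heq, Set.indicator_of_mem]
    rw [mem_ball, dist_zero_right]
    rw [mem_closedBall, dist_zero_right, Prod.norm_def] at hq
    have h1 : |q.1| ≤ rs := by simpa using (le_max_left _ _).trans hq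
    have h2 : |q.2| ≤ rs := by simpa using (le_max_right _ _).trans hq
    have hb0 : ‖EuclideanSpace.basisFun (Fin 3) ℝ 0‖ = 1 := (EuclideanSpace.basisFun (Fin 3) ℝ).orthonormal.1 0
    have hb1 : ‖EuclideanSpace.basisFun (Fin 3) ℝ 1‖ = 1 := (EuclideanSpace.basisFun (Fin 3) ℝ).orthonormal.1 1
    calc ‖y₁ + q.1 • EuclideanSpace.basisFun (Fin 3) ℝ 0 + q.2 • EuclideanSpace.basisFun (Fin 3) ℝ 1‖
        ≤ ‖y₁‖ + ‖q.1 • EuclideanSpace.basisFun (Fin 3) ℝ 0‖ + ‖q.2 • EuclideanSpace.basisFun (Fin 3) ℝ 1‖ :=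
          norm_add₃_le
      _ = ‖y₁‖ + |q.1| + |q.2| := by rw [norm_smul, norm_smul, hb0, hb1, Real.norm_eq_abs, Real.norm_eq_abs]; ring
      _ < 3 * R := by linarith
  -- the chart as a measurable equivalence, and the comparison
  set Φe : ℝ × ℝ ≃ᵐ EuclideanSpace ℝ (Fin 2) :=
    ((MeasurableEquiv.finTwoArrow (α := ℝ)).symm.trans (MeasurableEquiv.toLp 2 (Fin 2 → ℝ))).trans
      (MeasurableEquiv.addLeft c) with hΦe
  have hΦe_coe : ⇑Φe = Φ := by
    funext q
    simp [hΦe, hΦ, MeasurableEquiv.coe_addLeft]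
  have hΦemp : MeasurePreserving Φe volume volume := by
    rw [hΦe_coe]; exact hΦmp
  have hcomp : ∫ q, h (Φe q) = ∫ a, h a := hΦemp.integral_comp' h
  have hint_comp : Integrable (fun q => h (Φe q)) :=
    (hΦemp.integrable_comp_emb Φe.measurableEmbedding).2 hh_int
  calc ∫ q in closedBall (0 : ℝ × ℝ) rs,
        G (y₁ + q.1 • EuclideanSpace.basisFun (Fin 3) ℝ 0 + q.2 • EuclideanSpace.basisFun (Fin 3) ℝ 1)
      = ∫ q in closedBall (0 : ℝ × ℝ) rs, h (Φe q) :=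
        setIntegral_congr_fun measurableSet_closedBall fun q hq => by rw [hpt q hq, hΦe_coe]
    _ ≤ ∫ q, h (Φe q) := setIntegral_le_integral hint_comp (Filter.Eventually.of_forall fun q => hh0 _)
    _ = ∫ a, h a := hcomp

/-- **THE CONDENSER CORE ON A COORDINATE PLANE (t42-QP frame).**  `V ∈ C¹(ℝ³, F)`, `y₁ ∈ ℝ³` an ANOMALOUS point
(`‖V y₁‖ ≥ m > 0`) with `‖y₁‖ + 2r★ < 3R`, `‖DV‖ ≤ G_m` on `closedBall y₁ r★`, slice budgets (t42-QP form, slice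
`{x 2 = y₁ 2}`) `∫ a, 𝟙_{B(0,3R)}‖V‖² (plane (y₁ 2) a) ≤ A`, `∫ a, 𝟙_{B(0,3R)}‖DV‖² (plane (y₁ 2) a) ≤ E`, room
`8A/(π m²) ≤ (3/4) r★²`.  Then `(m/(4r★))·exp(π m²/(32E)) ≤ √2·G_m  ∨  π m²/(32E) ≤ log 2`.
[folklore (length–area method); cite: ConstantinIgnatovaVicol2026Putative, §3.4.1 for the setting] -/
theorem exp_le_gradient_or_small_of_plane {F : Type*} [NormedAddCommGroup F] [NormedSpace ℝ F] [CompleteSpace F]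
    {V : EuclideanSpace ℝ (Fin 3) → F} (hV : ContDiff ℝ 1 V) {y₁ : EuclideanSpace ℝ (Fin 3)} {R m rs Gm A E : ℝ}
    (hm : 0 < m) (hrs : 0 < rs) (hfit : ‖y₁‖ + 2 * rs < 3 * R) (h0 : m ≤ ‖V y₁‖)
    (hGm : ∀ z ∈ closedBall y₁ rs, ‖fderiv ℝ V z‖ ≤ Gm)
    (hA : ∫ a, (ball (0 : EuclideanSpace ℝ (Fin 3)) (3 * R)).indicator (fun x => ‖V x‖ ^ 2) (plane (y₁ 2) a) ≤ A)
    (hE : ∫ a, (ball (0 : EuclideanSpace ℝ (Fin 3)) (3 * R)).indicator (fun x => ‖fderiv ℝ V x‖ ^ 2)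
      (plane (y₁ 2) a) ≤ E)
    (hroom : 8 * A / (Real.pi * m ^ 2) ≤ 3 / 4 * rs ^ 2) :
    m / (4 * rs) * Real.exp (Real.pi * m ^ 2 / (32 * E)) ≤ Real.sqrt 2 * Gm ∨
      Real.pi * m ^ 2 / (32 * E) ≤ Real.log 2 := by
  set u : EuclideanSpace ℝ (Fin 3) := EuclideanSpace.basisFun (Fin 3) ℝ 0 with hu
  set v : EuclideanSpace ℝ (Fin 3) := EuclideanSpace.basisFun (Fin 3) ℝ 1 with hv
  have hu1 : ‖u‖ = 1 := (EuclideanSpace.basisFun (Fin 3) ℝ).orthonormal.1 0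
  have hv1 : ‖v‖ = 1 := (EuclideanSpace.basisFun (Fin 3) ℝ).orthonormal.1 1
  have huv : ⟪u, v⟫ = 0 := (EuclideanSpace.basisFun (Fin 3) ℝ).orthonormal.2 (by decide)
  have hA' : ∫ q in closedBall (0 : ℝ × ℝ) rs, ‖V (y₁ + q.1 • u + q.2 • v)‖ ^ 2 ≤ A :=
    (setIntegral_chart_le_integral_plane (G := fun x => ‖V x‖ ^ 2) (hV.continuous.norm.pow 2)
      (fun x => sq_nonneg _) hfit).trans hA
  have hE' : ∫ q in closedBall (0 : ℝ × ℝ) rs, ‖fderiv ℝ V (y₁ + q.1 • u + q.2 • v)‖ ^ 2 ≤ E :=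
    (setIntegral_chart_le_integral_plane (G := fun x => ‖fderiv ℝ V x‖ ^ 2)
      ((hV.continuous_fderiv one_ne_zero).norm.pow 2) (fun x => sq_nonneg _) hfit).trans hE
  exact exp_le_gradient_or_small_of_chart hV hu1 hv1 huv hm hrs h0 hGm hA' hE' hroom

end Summit.NavierStokesRegularity.NavierStokesRegularity.Theorems.PowerGaugeEulerLiouville.Condenser

end
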